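import Summits.CriticalPhenomena.PercolationContinuityZ3.Theorems.PercNearOneGluingNoHeavyLowerTailAntitheticContract
import Summits.CriticalPhenomena.PercolationContinuityZ3.Theorems.PercNearOneGluingNoHeavyLowerTailAntitheticCycleContractSum
import HarnessLib

/-!
# `NoHeavyLowerTail` (stmt-CriticalPhenomena-4575) — antithetic cluster pairs: CONTRACTING A DEGREE-2 VERTEX of an arbitrary graph (DEG-2
# ELIMINATION, part 2: the decomposition; prim-hp-2 gen 40, HOME/MEMO-gen40-theoremC-lean.md §3)

Support file (`--supports stmt-CriticalPhenomena-4575`, hull-port prover `prim-hp-2`, gen 40).  No definitions, no named facts, no sorries; standard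
axioms.

SETTING as in …AntitheticContract: `x ≠ s` meets exactly the pairs `e = xy`, `f = xz` of `E` (`y ≠ z`), `g = yz ∉ E`, `E' = (E ∖ {e,f}) ∪ {g}`.
* `Contract.both_swap`, `Contract.swap_mem_tset_iff` — for a tied colouring `ω'` (coordinates `g`, `f` agree) the constraints of `T_E(R,X)` at
  `swap ω'` and of `T_{E'}(R,X)` at `ω'` agree (`x ∉ X`; `x` is never reached in both colours on either side);
* `Contract.delta_swap` — `Δ_E(F,G)(swap ω') = Δ_{E'}(F ∘ expand, G ∘ expand)(ω')`;
* `Contract.contract_sum_eq` — **`2 · Σ_{ω ∈ tset_E(R,X), e ≡ f} Δ_E(F,G)(ω) = T_{E'}(R,X; F ∘ expand, G ∘ expand)`**;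
* `Contract.deg2_decomposition` — **DEG-2 ELIMINATION**: `2·T_E(R,X; F,G) = 2·[CHANGE part: Σ over tset_E(R,X) with e ≢ f] + T_{E'}(R,X; F∘expand, G∘expand)`;
* `Contract.good_of_change_nonneg` — hence `T_E(R,X) ≥ 0` as soon as the change part is `≥ 0` and the contracted edge set is good (`expand` is
  increasing, so goodness of `E'` for all increasing functions suffices).
On a cycle the change part at a forbidden vertex is THE STAIRCASE LEMMA (…CycleStairSum) and this decomposition is THEOREM C's induction step; for
general graphs the sign of the change part at a forbidden degree-2 vertex is CONJECTURE Δ2 of MEMO-gen40 §3.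
[cite: VandenbergHaggstromKahn2005, §1 p. 3 (open cluster `C_s`)]
-/

noncomputable section

namespace Summit.CriticalPhenomena.PercolationContinuityZ3.Theorems

open Literature.Probability.Percolation
open scoped Classical symmDiff

namespace Antithetic

namespace Contract

variable {V : Type*} {E : Set (Sym2 V)} {s x y z : V} (hxs : x ≠ s) (hxy : x ≠ y) (hxz : x ≠ z) (hyz : y ≠ z)
  (he : s(x, y) ∈ E) (hf : s(x, z) ∈ E) (hdeg : ∀ h ∈ E, x ∈ h → h = s(x, y) ∨ h = s(x, z)) (hg : s(y, z) ∉ E)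
include hxs hxy hxz hyz he hf hdeg hg

/-- **Double reach corresponds** (tied colourings): a vertex is joined to `s` in both colours of `swap ω'` on `E` iff it is in both colours of `ω'`
on `E'` (the vertex `x` is never doubly reached on either side). [this work] -/
theorem both_swap (ω' : Set (Sym2 V)) (hT : s(y, z) ∈ ω' ↔ s(x, z) ∈ ω') (r : V) :
    ((openGraph (swap s(x, y) s(y, z) ω' ∩ E)).Reachable s r ∧ (openGraph ((swap s(x, y) s(y, z) ω')ᶜ ∩ E)).Reachable s r) ↔
      ((openGraph (ω' ∩ insert s(y, z) (E \ {s(x, y), s(x, z)}))).Reachable s r ∧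
        (openGraph (ω'ᶜ ∩ insert s(y, z) (E \ {s(x, y), s(x, z)}))).Reachable s r) := by
  have hge := g_ne_e (y := y) (z := z) hxy hxz
  have hT' : s(y, z) ∈ ω'ᶜ ↔ s(x, z) ∈ ω'ᶜ := by rw [Set.mem_compl_iff, Set.mem_compl_iff, hT]
  rw [swap_compl hge]
  by_cases hr : r = x
  · subst hr
    rw [reach_swap_x hxs hxy hxz hyz he hf hdeg hg ω' hT, reach_swap_x hxs hxy hxz hyz he hf hdeg hg ω'ᶜ hT']
    constructor
    · rintro ⟨⟨h1, -⟩, ⟨h2, -⟩⟩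
      exact absurd h1 h2
    · rintro ⟨h1, -⟩
      exact absurd h1 (not_reach_contracted hxs hxy hxz hdeg ω')
  · rw [reach_swap hxs hxy hxz hyz he hf hdeg hg ω' hT hr, reach_swap hxs hxy hxz hyz he hf hdeg hg ω'ᶜ hT' hr]

/-- **Constraints correspond**: for a tied colouring `ω'` and `x ∉ X`, `swap ω' ∈ tset_E(R,X)` iff `ω' ∈ tset_{E'}(R,X)`. [this work] -/
theorem swap_mem_tset_iff [Fintype V] (R X : Set V) (hX : x ∉ X) (ω' : Set (Sym2 V)) (hT : s(y, z) ∈ ω' ↔ s(x, z) ∈ ω') :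
    swap s(x, y) s(y, z) ω' ∈ Peel.tset E s R X ↔ ω' ∈ Peel.tset (insert s(y, z) (E \ {s(x, y), s(x, z)})) s R X := by
  have hge := g_ne_e (y := y) (z := z) hxy hxz
  have hT' : s(y, z) ∈ ω'ᶜ ↔ s(x, z) ∈ ω'ᶜ := by rw [Set.mem_compl_iff, Set.mem_compl_iff, hT]
  have hsink : ∀ u ∈ X, ((¬ (openGraph (swap s(x, y) s(y, z) ω' ∩ E)).Reachable s u ∧
      ¬ (openGraph ((swap s(x, y) s(y, z) ω')ᶜ ∩ E)).Reachable s u) ↔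
      (¬ (openGraph (ω' ∩ insert s(y, z) (E \ {s(x, y), s(x, z)}))).Reachable s u ∧
        ¬ (openGraph (ω'ᶜ ∩ insert s(y, z) (E \ {s(x, y), s(x, z)}))).Reachable s u)) := by
    intro u hu
    have hux : u ≠ x := fun h => hX (h ▸ hu)
    rw [swap_compl hge, reach_swap hxs hxy hxz hyz he hf hdeg hg ω' hT hux, reach_swap hxs hxy hxz hyz he hf hdeg hg ω'ᶜ hT' hux]
  rw [Peel.mem_tset, Peel.mem_tset]
  constructor
  · rintro ⟨h1, h2⟩
    exact ⟨fun r hr => by rw [← both_swap hxs hxy hxz hyz he hf hdeg hg ω' hT r]; exact h1 r hr, fun u hu => (hsink u hu).1 (h2 u hu)⟩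
  · rintro ⟨h1, h2⟩
    exact ⟨fun r hr => by rw [both_swap hxs hxy hxz hyz he hf hdeg hg ω' hT r]; exact h1 r hr, fun u hu => (hsink u hu).2 (h2 u hu)⟩

/-- **The functional corresponds**: `Δ_E(F,G)(swap ω') = Δ_{E'}(F ∘ expand, G ∘ expand)(ω')` for tied `ω'`. [this work] -/
theorem delta_swap (F G : Set (Sym2 V) → ℝ) (ω' : Set (Sym2 V)) (hT : s(y, z) ∈ ω' ↔ s(x, z) ∈ ω') :
    Peel.delta F G E s (swap s(x, y) s(y, z) ω') =
      Peel.delta (F ∘ expand s(x, y) s(x, z) s(y, z)) (G ∘ expand s(x, y) s(x, z) s(y, z)) (insert s(y, z) (E \ {s(x, y), s(x, z)})) s ω' := by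
  have hge := g_ne_e (y := y) (z := z) hxy hxz
  have hT' : s(y, z) ∈ ω'ᶜ ↔ s(x, z) ∈ ω'ᶜ := by rw [Set.mem_compl_iff, Set.mem_compl_iff, hT]
  unfold Peel.delta
  rw [swap_compl hge, cluster_swap hxs hxy hxz hyz he hf hdeg hg ω' hT, cluster_swap hxs hxy hxz hyz he hf hdeg hg ω'ᶜ hT']
  rfl

section Sum

variable [Fintype V]

/-- **THE CONTRACTION IDENTITY**: twice the constrained antithetic sum over the colourings of `tset_E(R,X)` in which `e` and `f` have the same colour
equals the constrained sum `T_{E'}(R,X)` of the contracted edge set for the pulled-back functions (`x ∉ X`). [this work] -/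
theorem contract_sum_eq (F G : Set (Sym2 V) → ℝ) (R X : Set V) (hX : x ∉ X) :
    2 * ∑ ω ∈ (Peel.tset E s R X).filter (fun ω => (s(x, y) ∈ ω ↔ s(x, z) ∈ ω)), Peel.delta F G E s ω =
      Peel.tsum (F ∘ expand s(x, y) s(x, z) s(y, z)) (G ∘ expand s(x, y) s(x, z) s(y, z)) (insert s(y, z) (E \ {s(x, y), s(x, z)})) s R X := by
  have hge := g_ne_e (y := y) (z := z) hxy hxz
  have hgf := g_ne_f (y := y) (z := z) hxy hxz
  have hef := e_ne_f (x := x) hyz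
  set E' := insert s(y, z) (E \ {s(x, y), s(x, z)}) with hE'
  have hfE' : s(x, z) ∉ E' := fun h => by
    rcases mem_contracted.1 h with h | ⟨-, -, h⟩
    · exact hgf h.symm
    · exact h rfl
  set F' := F ∘ expand s(x, y) s(x, z) s(y, z) with hF'
  set G' := G ∘ expand s(x, y) s(x, z) s(y, z) with hG'
  set T : Set (Sym2 V) → Prop := fun ω' => (s(y, z) ∈ ω' ↔ s(x, z) ∈ ω') with hTdef
  -- Step 1: reindex the tied colourings of E by `swap`
  have step1 : ∑ ω ∈ (Peel.tset E s R X).filter (fun ω => (s(x, y) ∈ ω ↔ s(x, z) ∈ ω)), Peel.delta F G E s ω =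
      ∑ ω' ∈ (Peel.tset E' s R X).filter (fun ω' => T ω'), Peel.delta F' G' E' s ω' := by
    symm
    refine Finset.sum_nbij' (swap s(x, y) s(y, z)) (swap s(x, y) s(y, z)) ?_ ?_ (fun ω' _ => swap_swap hge ω')
      (fun ω _ => swap_swap hge ω) ?_
    · intro ω' hω'
      rw [Finset.mem_filter] at hω' ⊢
      obtain ⟨hmem, hT⟩ := hω'
      refine ⟨(swap_mem_tset_iff hxs hxy hxz hyz he hf hdeg hg R X hX ω' hT).2 hmem, ?_⟩
      rw [mem_swap_e hge, mem_swap_other ω' hgf.symm (Ne.symm hef)]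
      exact hT
    · intro ω hω
      rw [Finset.mem_filter] at hω ⊢
      obtain ⟨hmem, hTb⟩ := hω
      have hT : T (swap s(x, y) s(y, z) ω) := by
        show s(y, z) ∈ swap s(x, y) s(y, z) ω ↔ s(x, z) ∈ swap s(x, y) s(y, z) ω
        rw [mem_swap_g hge, mem_swap_other ω hgf.symm (Ne.symm hef)]
        exact hTb
      refine ⟨(swap_mem_tset_iff hxs hxy hxz hyz he hf hdeg hg R X hX _ hT).1 ?_, hT⟩
      rw [swap_swap hge]
      exact hmem
    · intro ω' hω'
      rw [Finset.mem_filter] at hω'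
      exact (delta_swap hxs hxy hxz hyz he hf hdeg hg F G ω' hω'.2).symm
  -- Step 2: on E', flipping the free coordinate f exchanges tied and untied colourings
  have hflip_tset : ∀ ω' : Set (Sym2 V), ω' ∆ {s(x, z)} ∈ Peel.tset E' s R X ↔ ω' ∈ Peel.tset E' s R X := fun ω' => by
    rw [Peel.mem_tset, Peel.mem_tset, Cyc.symmDiff_singleton_inter hfE', Cyc.compl_symmDiff_singleton_inter hfE']
  have hflip_T : ∀ ω' : Set (Sym2 V), T (ω' ∆ {s(x, z)}) ↔ ¬ T ω' := fun ω' => by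
    have h1 : s(y, z) ∈ ω' ∆ {s(x, z)} ↔ s(y, z) ∈ ω' := by
      rw [Set.mem_symmDiff, Set.mem_singleton_iff]
      constructor
      · rintro (⟨h, -⟩ | ⟨h, -⟩)
        · exact h
        · exact absurd h hgf
      · exact fun h => Or.inl ⟨h, hgf⟩
    have h2 : s(x, z) ∈ ω' ∆ {s(x, z)} ↔ s(x, z) ∉ ω' := by
      rw [Set.mem_symmDiff, Set.mem_singleton_iff]
      constructor
      · rintro (⟨-, h⟩ | ⟨-, h⟩)
        · exact absurd rfl h
        · exact h
      · exact fun h => Or.inr ⟨rfl, h⟩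
    show ((s(y, z) ∈ ω' ∆ {s(x, z)} ↔ s(x, z) ∈ ω' ∆ {s(x, z)})) ↔ ¬ (s(y, z) ∈ ω' ↔ s(x, z) ∈ ω')
    rw [h1, h2]
    tauto
  have hflip_delta : ∀ ω' : Set (Sym2 V), Peel.delta F' G' E' s (ω' ∆ {s(x, z)}) = Peel.delta F' G' E' s ω' := fun ω' => by
    unfold Peel.delta
    rw [Cyc.symmDiff_singleton_inter hfE', Cyc.compl_symmDiff_singleton_inter hfE']
  have step2 : ∑ ω' ∈ (Peel.tset E' s R X).filter (fun ω' => ¬ T ω'), Peel.delta F' G' E' s ω' =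
      ∑ ω' ∈ (Peel.tset E' s R X).filter (fun ω' => T ω'), Peel.delta F' G' E' s ω' := by
    refine Finset.sum_nbij' (· ∆ {s(x, z)}) (· ∆ {s(x, z)}) ?_ ?_ (fun ω' _ => symmDiff_symmDiff_cancel_right _ _)
      (fun ω' _ => symmDiff_symmDiff_cancel_right _ _) fun ω' _ => (hflip_delta ω').symm
    · intro ω' hω'
      rw [Finset.mem_filter] at hω' ⊢
      exact ⟨(hflip_tset ω').2 hω'.1, (hflip_T ω').2 hω'.2⟩
    · intro ω' hω'
      rw [Finset.mem_filter] at hω' ⊢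
      refine ⟨(hflip_tset ω').2 hω'.1, fun h => ?_⟩
      have := (hflip_T (ω' ∆ {s(x, z)})).1 (by rw [symmDiff_symmDiff_cancel_right]; exact hω'.2)
      exact this h
  rw [step1, Peel.tsum, ← Finset.sum_filter_add_sum_filter_not (Peel.tset E' s R X) (fun ω' => T ω'), step2, two_mul]

/-- **DEG-2 ELIMINATION (the decomposition).**  For a vertex `x ≠ s`, `x ∉ X`, meeting exactly the pairs `xy, xz` of `E` (`yz ∉ E`):
`2 · T_E(R,X; F,G) = 2 · [CHANGE PART: Σ over ω ∈ tset_E(R,X) with xy, xz of different colours of Δ_E(F,G)(ω)] + T_{E'}(R,X; F∘expand, G∘expand)`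
with `E' = (E ∖ {xy, xz}) ∪ {yz}` the contraction of `x`. [this work] -/
theorem deg2_decomposition (F G : Set (Sym2 V) → ℝ) (R X : Set V) (hX : x ∉ X) :
    2 * Peel.tsum F G E s R X =
      2 * (∑ ω ∈ (Peel.tset E s R X).filter (fun ω => ¬ (s(x, y) ∈ ω ↔ s(x, z) ∈ ω)), Peel.delta F G E s ω) +
        Peel.tsum (F ∘ expand s(x, y) s(x, z) s(y, z)) (G ∘ expand s(x, y) s(x, z) s(y, z)) (insert s(y, z) (E \ {s(x, y), s(x, z)})) s R X := by
  rw [← contract_sum_eq hxs hxy hxz hyz he hf hdeg hg F G R X hX, Peel.tsum,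
    ← Finset.sum_filter_add_sum_filter_not (Peel.tset E s R X) (fun ω => ¬ (s(x, y) ∈ ω ↔ s(x, z) ∈ ω))]
  have : (Peel.tset E s R X).filter (fun ω => ¬ ¬ (s(x, y) ∈ ω ↔ s(x, z) ∈ ω)) =
      (Peel.tset E s R X).filter (fun ω => (s(x, y) ∈ ω ↔ s(x, z) ∈ ω)) := Finset.filter_congr fun ω _ => not_not
  rw [this]
  ring

/-- **DEG-2 ELIMINATION (the reduction).**  If the change part at `x` is nonnegative and the contracted edge set `E'` is good for `(R, X)`
(`0 ≤ T_{E'}(R,X)` for all increasing functions), then `0 ≤ T_E(R,X; F,G)`. [this work] -/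
theorem good_of_change_nonneg {F G : Set (Sym2 V) → ℝ} (hF : Monotone F) (hG : Monotone G) (R X : Set V) (hX : x ∉ X)
    (hchg : 0 ≤ ∑ ω ∈ (Peel.tset E s R X).filter (fun ω => ¬ (s(x, y) ∈ ω ↔ s(x, z) ∈ ω)), Peel.delta F G E s ω)
    (hgood : ∀ F' G' : Set (Sym2 V) → ℝ, Monotone F' → Monotone G' →
      0 ≤ Peel.tsum F' G' (insert s(y, z) (E \ {s(x, y), s(x, z)})) s R X) :
    0 ≤ Peel.tsum F G E s R X := by
  have h := deg2_decomposition hxs hxy hxz hyz he hf hdeg hg F G R X hX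
  have h' := hgood _ _ (hF.comp (expand_mono s(x, y) s(x, z) s(y, z))) (hG.comp (expand_mono s(x, y) s(x, z) s(y, z)))
  linarith

end Sum

end Contract

end Antithetic

end Summit.CriticalPhenomena.PercolationContinuityZ3.Theorems
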